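import Literature.AlgebraicGeometry.Morphisms.PrincipalAffineCoverOfProj
import Literature.AlgebraicGeometry.Morphisms.PrincipalAffineCoverRefinement
import Literature.AlgebraicGeometry.Morphisms.ProjectiveMorphism
import Literature.AlgebraicGeometry.Modules.FiniteAffineTrivialisingCover
import Literature.AlgebraicGeometry.Modules.IndexedFrames
import HarnessLib

/-!
# A scheme projective over an affine base has a finite PRINCIPAL affine cover trivialising a given line bundle
# (Hartshorne II Prop. 2.5 / §4 Definition p. 103 with II §5 (p. 109) and Ex. II.5.16; Stacks 01JS, 01K4)

Layer `Literature/AlgebraicGeometry/Morphisms`, namespace `Literature.AlgebraicGeometry.Morphisms`.  THEOREMS ONLY (no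
definition, no named fact, no instance), pure assembly over ★ tree lemmas:

* (E) ★ `exists_principal_affine_cover_of_isProjective` (`Morphisms/PrincipalAffineCoverOfProj`): a scheme `f : X → Y`
  PROJECTIVE (★ `Morphisms.IsProjective`: a closed immersion into `𝐏(ι; Y)` over `Y`) over an AFFINE `Y` has a finite
  PRINCIPAL AFFINE COVER `(U, b, hb)`: affine opens `U_a` with `U_a ∩ U_c = D(b_{ac})`, `b_{ac} ∈ Γ(X, U_a)`;
* (R) ★ `exists_finite_principal_affine_cover_refinement` (`Morphisms/PrincipalAffineCoverRefinement`): on a quasi-compact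
  scheme a principal affine cover refines to a FINITE principal affine cover subordinate to any open cover;
* ★ `Modules.exists_frameSystem_of_hasRank` (`Modules/RankOneCocycle`): a module of rank `1` (`HasRank L 1`) has, at every
  point, an open neighbourhood with a frame `𝒪^{I_x} ≅ L|_{U_x}`, `I_x ≃ Fin 1`; restricted to smaller opens by Mathlib's
  `SheafOfModules.restrictTrivialisation` and re-indexed by `PUnit` (pattern of ★ `Modules/FiniteAffineTrivialisingCover`).

Results:

* **`exists_finite_principal_affine_cover_with_frames_of_isProjective`** — for `f : X → Y` projective, `Y` affine, and an
  `𝒪_X`-module `L` of rank `1`, there is a FINITE principal affine cover `(U, b)` of `X` each of whose members carries a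
  frame `𝒪 ≅ L|_{U_j}` (stated as `Nonempty (SheafOfModules.free PUnit ≅ L.over (U j).1)`);
* **`exists_finite_principal_affine_cover_iframes_of_isProjective`** — the same with the frames packaged as an indexed
  frame system ★ `Modules.IFrames L (fun j => (U j).1)` (the currency of the tree's Čech unit-cocycle ∕ `dlog` files);
* `exists_finite_principal_affine_cover_with_frames` ∕ `…_iframes` — the same for any QUASI-COMPACT `X` admitting SOME
  principal affine cover (the refinement step alone), and `compactSpace_of_isProjective` — `X` projective over an affine
  base is quasi-compact (★ `IsProjective.isProper`, Mathlib `QuasiCompact.compactSpace_of_compactSpace`).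

Cell `hodgecm-mathlib` (D-0151), F-11 α1 grandchild `F11LiftWithLineBundle`, MONO-G2 fit list brick B3 (F0P1b-plan (g0)
(R45)(b)∕(R53) #2): the cover on which the (iii) pair-obstruction package (★ `PairLiftObstructionSplitsOfLineBundleLift`) and
★ `Morphisms/PrincipalAffineCoverLiftFrames.exists_principal_affine_cover_lift_with_frames_of_isPullback` (p07) are run
(`X := A₀.X.left` projective over the affine Artin base, `L := L₀`; `W := fun j => (U j).1`, `hsub := ⟨j, le_rfl⟩`), and the
binder block `(U) (hcov) (F : IFrames L (fun j => (U j).1))` of the (I2) sockets.  Generic and count-neutral; HC_CM is proved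
only modulo the 7 printed citations until rung 0 closes — nothing here refers to it.  Mathlib searched (pin v4.32):
`QuasiCompact.compactSpace_of_compactSpace`, `SheafOfModules.freeFunctor`, `Equiv.ofUnique`, `finCongr` (used).

## References

* R. Hartshorne, *Algebraic Geometry*, GTM 52 (1977): II Prop. 2.5 (pp. 76–77), II §4 Definition (p. 103), II Thm. 4.9,
  II §5 (p. 109) and Ex. II.5.16, II Ex. 2.16 (a). [Hartshorne1977]
* The Stacks Project, Tag 01JS (standard affine cover of `𝐏ⁿ`), Tag 01K4 (quasi-compact schemes). [StacksProject]
-/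

noncomputable section

open CategoryTheory CategoryTheory.Limits AlgebraicGeometry TopologicalSpace

universe u

namespace Literature.AlgebraicGeometry.Morphisms

open Literature.AlgebraicGeometry.Motives Literature.AlgebraicGeometry.Modules

/-! ## Quasi-compact schemes with a principal affine cover -/

/-- **Refinement step**: on a quasi-compact scheme `X` with SOME principal affine cover `(U, b)`, a rank-one `𝒪_X`-module
`L` is trivialised on the members of a FINITE principal affine cover (refine `(U, b)` by ★ (R) to be subordinate to the
trivialising neighbourhoods of a frame system of `L`, restrict the frames and re-index them by `PUnit`).
[cite: Hartshorne1977, II §5 (p. 109) and Ex. II.5.16] [cite: StacksProject, Tag 01K4] -/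
theorem exists_finite_principal_affine_cover_with_frames {X : Scheme.{u}} [CompactSpace X] {ι₀ : Type*}
    (U : ι₀ → X.affineOpens) (b : (j l : ι₀) → Γ(X, (U j).1)) (hb : ∀ j l, (U j).1 ⊓ (U l).1 = X.basicOpen (b j l))
    (hU : ⨆ j, (U j).1 = ⊤) (L : X.Modules) (hL : HasRank L 1) :
    ∃ (ι : Type u) (_ : Finite ι) (V : ι → X.affineOpens) (c : (j l : ι) → Γ(X, (V j).1)),
      (∀ j l, (V j).1 ⊓ (V l).1 = X.basicOpen (c j l)) ∧ (⨆ j, (V j).1 = ⊤) ∧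
      ∀ j, Nonempty (SheafOfModules.free (PUnit : Type u) ≅ L.over (V j).1) := by
  -- a frame system of constant rank `1`
  obtain ⟨F, hF⟩ := exists_frameSystem_of_hasRank hL
  have hW : ⨆ x, F.U x = ⊤ := top_le_iff.mp fun x _ => Opens.mem_iSup.mpr ⟨x, F.mem x⟩
  -- refine the principal cover to a finite principal cover subordinate to the `F.U x`
  obtain ⟨ι, hι, V, c, hcov, hc, -, hVW⟩ := exists_finite_principal_affine_cover_refinement U b hb hU F.U hW
  refine ⟨ι, hι, V, c, hc, hcov, fun j => ?_⟩
  obtain ⟨x, hx⟩ := hVW j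
  -- restrict the frame at `x` to `V j` and re-index `F.I x ≃ Fin 1 ≃ PUnit`
  let e : F.I x ≃ (PUnit : Type u) := ((F.enum x).trans (finCongr (hF x))).trans (Equiv.ofUnique _ _)
  have hr : SheafOfModules.free (F.I x) ≅ L.over (V j).1 :=
    SheafOfModules.restrictTrivialisation (R := X.ringCatSheaf) (homOfLE hx) (F.frame x)
  exact ⟨((SheafOfModules.freeFunctor).mapIso e.toIso).symm ≪≫ hr⟩

/-- The same with the frames packaged as an indexed frame system `IFrames L (fun j => (V j).1)` (the currency of the tree's
`Modules/IndexedFrames`, `Morphisms/CechUnitCocycle…` files). [cite: Hartshorne1977, II §5 (p. 109) and Ex. II.5.16]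
[cite: StacksProject, Tag 01K4] -/
theorem exists_finite_principal_affine_cover_iframes {X : Scheme.{u}} [CompactSpace X] {ι₀ : Type*}
    (U : ι₀ → X.affineOpens) (b : (j l : ι₀) → Γ(X, (U j).1)) (hb : ∀ j l, (U j).1 ⊓ (U l).1 = X.basicOpen (b j l))
    (hU : ⨆ j, (U j).1 = ⊤) (L : X.Modules) (hL : HasRank L 1) :
    ∃ (ι : Type u) (_ : Finite ι) (V : ι → X.affineOpens) (c : (j l : ι) → Γ(X, (V j).1)),
      (∀ j l, (V j).1 ⊓ (V l).1 = X.basicOpen (c j l)) ∧ (⨆ j, (V j).1 = ⊤) ∧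
      Nonempty (IFrames L (fun j => (V j).1)) := by
  obtain ⟨ι, hι, V, c, hc, hcov, hfr⟩ := exists_finite_principal_affine_cover_with_frames U b hb hU L hL
  exact ⟨ι, hι, V, c, hc, hcov, ⟨⟨fun j => (hfr j).some⟩⟩⟩

/-! ## Projective over an affine base -/

/-- A scheme projective over an affine base is quasi-compact (projective ⇒ proper ⇒ quasi-compact, and an affine scheme is
quasi-compact). [cite: Hartshorne1977, II Thm. 4.9 and §4 Definition (p. 103)] -/
theorem compactSpace_of_isProjective {X Y : Scheme.{u}} [IsAffine Y] {f : X ⟶ Y} (hf : IsProjective f) :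
    CompactSpace X := by
  haveI := hf.isProper
  exact QuasiCompact.compactSpace_of_compactSpace f

/-- **A scheme projective over an affine base has a finite PRINCIPAL affine cover trivialising a given rank-one module**:
for `f : X → Y` projective (★ `IsProjective`), `Y` affine, and an `𝒪_X`-module `L` of rank `1`, there are finitely many
affine opens `U_j` covering `X` with `U_j ∩ U_l = D(b_{jl})`, `b_{jl} ∈ Γ(X, U_j)`, and frames `𝒪 ≅ L|_{U_j}`.  (★ (E): the
pull-back of the standard cover of `𝐏ⁿ` is a principal affine cover; then the refinement step.)
[cite: Hartshorne1977, II Prop. 2.5 (b) and proof (pp. 76–77), II §5 (p. 109) and Ex. II.5.16] [cite: StacksProject, Tag 01JS] -/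
theorem exists_finite_principal_affine_cover_with_frames_of_isProjective {X Y : Scheme.{u}} [IsAffine Y] {f : X ⟶ Y}
    (hf : IsProjective f) (L : X.Modules) (hL : HasRank L 1) :
    ∃ (ι : Type u) (_ : Finite ι) (U : ι → X.affineOpens) (b : (j l : ι) → Γ(X, (U j).1)),
      (∀ j l, (U j).1 ⊓ (U l).1 = X.basicOpen (b j l)) ∧ (⨆ j, (U j).1 = ⊤) ∧
      ∀ j, Nonempty (SheafOfModules.free (PUnit : Type u) ≅ L.over (U j).1) := by
  haveI := compactSpace_of_isProjective hf
  obtain ⟨ι₀, _, U, b, hU, hb⟩ := exists_principal_affine_cover_of_isProjective hf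
  exact exists_finite_principal_affine_cover_with_frames U b hb hU L hL

/-- The same with the frames packaged as `IFrames L (fun j => (U j).1)` — the binder block
`{ι : Type u} [Finite ι] (U : ι → X.affineOpens) (hcov : ⨆ j, (U j).1 = ⊤) (F : IFrames L (fun j => (U j).1))` of the tree's
Čech unit-cocycle consumers, together with the principal-cover sections `b`.
[cite: Hartshorne1977, II Prop. 2.5 (b) and proof (pp. 76–77), II §5 (p. 109) and Ex. II.5.16] [cite: StacksProject, Tag 01JS] -/
theorem exists_finite_principal_affine_cover_iframes_of_isProjective {X Y : Scheme.{u}} [IsAffine Y] {f : X ⟶ Y}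
    (hf : IsProjective f) (L : X.Modules) (hL : HasRank L 1) :
    ∃ (ι : Type u) (_ : Finite ι) (U : ι → X.affineOpens) (b : (j l : ι) → Γ(X, (U j).1)),
      (∀ j l, (U j).1 ⊓ (U l).1 = X.basicOpen (b j l)) ∧ (⨆ j, (U j).1 = ⊤) ∧
      Nonempty (IFrames L (fun j => (U j).1)) := by
  haveI := compactSpace_of_isProjective hf
  obtain ⟨ι₀, _, U, b, hU, hb⟩ := exists_principal_affine_cover_of_isProjective hf
  exact exists_finite_principal_affine_cover_iframes U b hb hU L hL

end Literature.AlgebraicGeometry.Morphisms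

end
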